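import Literature.AlgebraicGeometry.Frobenioids.Cor54RigidityLinearSaturation
import Literature.AlgebraicGeometry.Frobenioids.Cor54RigidityArithSqueeze
import Literature.AlgebraicGeometry.Frobenioids.Cor54RigidityArithDegreeBase
import Literature.AlgebraicGeometry.Frobenioids.Cor54RigidityArithSaturation
import Literature.AlgebraicGeometry.Frobenioids.ArithmeticRealificationFractionalPart
import Literature.AlgebraicGeometry.Frobenioids.Cor54RigidityArithObjects
import Literature.AlgebraicGeometry.Frobenioids.Cor54RigidityLinearReduction
import Literature.AlgebraicGeometry.Frobenioids.Cor54RigidityReduction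
import Literature.AlgebraicGeometry.Frobenioids.FrobenioidRealificationCanonical
import Literature.AlgebraicGeometry.Frobenioids.RealificationPicLemmas
import HarnessLib

/-!
# Frobenioids I, Corollary 5.4 at the arithmetic Frobenioid `C_{K/F}`: hom-rigidity of `C^un-tr → C^rlf` on
# identity-base linear morphisms and the rigidity `hrig` (sub-DAG row C54-core-arith, sub-row (4): ASSEMBLY)

Mochizuki, *The geometry of Frobenioids I: the general theory*, Kyushu J. Math. **62** (2008) 293–400,
Corollary 5.4, kurims p. 104 ll. 1–9 ("there exists a 1-unique functor `Ψ^rlf : C₁^rlf → C₂^rlf` …"), at the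
arithmetic Frobenioids `C_{K/F}` of Example 6.3 / Theorem 6.4 pp. 113–116 (model descriptions of Prop. 5.3 p. 103,
morphisms `(deg_Fr, Base, Div, u)` of Thm. 5.2 (i) p. 100). [cite: MochizukiFrdI2008, Cor. 5.4 p.104]

PROOF-ONLY file (cell abc-iut, seat abc-iut-w5-d227, L1-lead R124 (1); no definitions). It ASSEMBLES the
row's landed pieces BY NAME — abc-iut-L1-d8's generic reductions (`Cor54RigidityLinearReduction/Transport/
Cocycle/Saturation`), abc-iut-L1-d9's coordinate squeeze and integrality (`Cor54RigidityArithSqueeze`),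
abc-iut-L1-d8's arithmetic (B1) and saturation (`Cor54RigidityArithDegreeBase`,
`Cor54RigidityArithSaturation`), abc-iut-w5-d048's essential surjectivity and generic reduction
(`Cor54RigidityArithObjects`, `Cor54RigidityReduction`) — into:

* `ModelFrobenioid.DataHom.eq_of_linear_of_inputs` — GENERIC (model level): `ρ k = k` for identity-base linear `k`
  from the named inputs (injective `η^gp`, cancellative `Φ'(A)`, saturation, `Div_{B'}` injective, `B'(A)` group-like,
  archimedean squeeze, (B1), (D1)), via the divisor cocycle and abc-iut-L1-d8's (c4′)(c5)(c7);
* `FrdI.Cor54Sub.hlin_arith_of` — for a functorial self-map `ρ` of the morphisms between `untrToRlf`-image objects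
  fixing the images: `ρ k = k` for every identity-base LINEAR `k`, GIVEN the one arithmetic input still owed by
  another seat as a named hypothesis: `hsmall` (small realisations of unit classes, sub-row (D1), abc-iut-L1-d2);
  (B1) `deg_Fr(ρ k) = 1 ∧ Base(ρ k) = id` is abc-iut-L1-d8's `degFr_base_rho_linear_arith`, saturation is its
  `toRlf_saturated_arith`;
* `FrdI.Cor54Sub.hrig_arith_of` — hence, with (a′) `untrToRlf_exists_iso_arith`, the RIGIDITY `hrig` consumed by
  `FrdI.Cor54Sub.strongUnique_of_rigidAlong_untrToRlf` (p420214): every endofunctor `T` of `C_{K/F}^rlf` with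
  `untrToRlf ⋙ T ≅ untrToRlf` is `≅ 𝟭`, modulo `hsmall`.

HONEST SCOPE: the as-typed strong 1-uniqueness clause of `PreFrobenioid.Cor54` is STRONGER than what the printed
proof of Cor. 5.4 delivers (cell record: row C54/L07 `OneUniqueData` is the clause of record); this file concerns
THE arithmetic data only. Nothing here bears on [IUTchIII] Cor. 3.12.
-/

noncomputable section

namespace Literature.AlgebraicGeometry.Frobenioids

/-! ### Generic assembly (model level): `ρ k = k` on identity-base linear morphisms from the row's pieces -/

namespace ModelFrobenioid.DataHom

open CategoryTheory Opposite

universe w v u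

variable {D : Type u} [Category.{v} D] {Φ B Φ' B' : Dᵒᵖ ⥤ CommMonCat.{w}} {DivB : B ⟶ monoidGp Φ}
  {DivB' : B' ⟶ monoidGp Φ'} (h : DataHom DivB DivB')

/-- **Hom-rigidity on identity-base linear morphisms, assembled from the row's generic pieces.** Let `G = h.functor`,
`ρ` a functorial self-map of the morphisms between `G`-image objects fixing the `G f`, and `A ∈ Ob(D)` with
`Φ'(A)` cancellative, `η^gp` injective at `A`, `η` SATURATED at `A` (`hsat`), `Div_{B'}` injective at `A`,
`B'(A)` group-like (`hinv`), the ARCHIMEDEAN SQUEEZE in `Φ'(A)^gp` (`hsq`: `c · δ^n` effective for all `n ∈ ℤ`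
forces `δ = 1`), the (B1) input `hB1` (`ρ` keeps identity-base linear morphisms identity-base linear) and the
(D1) input `hsmall` (every unit class has identity-base linear realisations with all its powers as unit
coordinate and BOUNDED zero divisor). Then `ρ k = k` for every identity-base linear `k : G(A, γ) → G(A, γ')`:
the divisor cocycle `δ(k) = Div(ρ k) / Div(k)` satisfies `Div(S)·δ(k)^n` effective for all `n ∈ ℤ`
(abc-iut-L1-d8's (c4′)(c5)(c7) on the small realisations), hence `δ(k) = 1` (`hsq`), hence `Div(ρ k) = Div k`
and `u_{ρ k} = u_k` ((c3) + injectivity of `Div_{B'}`). [cite: MochizukiFrdI2008, Cor. 5.4 p.104] -/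
theorem eq_of_linear_of_inputs
    (ρ : ∀ ⦃a a' : ModelFrobenioid Φ B DivB⦄,
      (h.functor.obj a ⟶ h.functor.obj a') → (h.functor.obj a ⟶ h.functor.obj a'))
    (hcomp : ∀ ⦃a a' a'' : ModelFrobenioid Φ B DivB⦄ (k : h.functor.obj a ⟶ h.functor.obj a')
      (l : h.functor.obj a' ⟶ h.functor.obj a''), ρ (k ≫ l) = ρ k ≫ ρ l)
    (hmap : ∀ ⦃a a' : ModelFrobenioid Φ B DivB⦄ (f : a ⟶ a'), ρ (h.functor.map f) = h.functor.map f)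
    (A : D) [IsCancelMul (Φ'.obj (op A))] (hι : Function.Injective (gpApp h.η (op A)))
    (hsat : ∀ (x : Φ'.obj (op A)) (q : Algebra.GrothendieckGroup (Φ.obj (op A))),
      Algebra.GrothendieckGroup.of x = gpApp h.η (op A) q → ∃ w : Φ.obj (op A), (h.η.app (op A)).hom w = x)
    (hdivB : Function.Injective (divB Φ' B' DivB' (op A)))
    (hinv : ∀ uu : B'.obj (op A), ∃ uinv : B'.obj (op A), uinv * uu = 1)
    (hsq : ∀ (δ : Algebra.GrothendieckGroup (Φ'.obj (op A))) (c : Φ'.obj (op A)),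
      (∀ n : ℤ, ∃ e : Φ'.obj (op A), Algebra.GrothendieckGroup.of c * δ ^ n = Algebra.GrothendieckGroup.of e) →
        δ = 1)
    (hB1 : ∀ (γ γ' : Algebra.GrothendieckGroup (Φ.obj (op A)))
      (k : h.functor.obj ⟨A, γ⟩ ⟶ h.functor.obj ⟨A, γ'⟩), degFr k = 1 → baseMap k = 𝟙 A →
        degFr (ρ k) = 1 ∧ baseMap (ρ k) = 𝟙 A)
    (hsmall : ∀ uu : B'.obj (op A), ∃ S : Φ'.obj (op A), ∀ n : ℕ,
      ∃ (β β' : Algebra.GrothendieckGroup (Φ.obj (op A))) (kn : h.functor.obj ⟨A, β⟩ ⟶ h.functor.obj ⟨A, β'⟩)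
        (zn e : Φ'.obj (op A)), degFr kn = 1 ∧ baseMap kn = 𝟙 A ∧ div kn = zn ∧ unit kn = uu ^ n ∧ zn * e = S)
    (γ γ' : Algebra.GrothendieckGroup (Φ.obj (op A))) (k : h.functor.obj ⟨A, γ⟩ ⟶ h.functor.obj ⟨A, γ'⟩)
    (hd : degFr k = 1) (hb : baseMap k = 𝟙 A) : ρ k = k := by
  obtain ⟨hρd, hρb⟩ := hB1 γ γ' k hd hb
  -- notation: `of`, the components of `k` and `ρ k`
  set z : Φ'.obj (op A) := div k with hz
  set uu : B'.obj (op A) := unit k with hu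
  set c : Φ'.obj (op A) := div (ρ k) with hc
  set uu' : B'.obj (op A) := unit (ρ k) with hu'
  let ofR : Φ'.obj (op A) →* Algebra.GrothendieckGroup (Φ'.obj (op A)) := Algebra.GrothendieckGroup.of
  -- the divisor cocycle of `k`
  set δ : Algebra.GrothendieckGroup (Φ'.obj (op A)) := ofR c / ofR z with hδ
  /- (P) POSITIVE POWERS along small realisations of `u^n`: `of(S) · δ^n` is effective for `n ≥ 1`, for ANY
     identity-base linear `k₀` with unit `u₀`, cocycle `δ₀` and small realisations with bound `S`. -/
  have hP : ∀ (γ₀ γ₀' : Algebra.GrothendieckGroup (Φ.obj (op A)))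
      (k₀ : h.functor.obj ⟨A, γ₀⟩ ⟶ h.functor.obj ⟨A, γ₀'⟩) (hd₀ : degFr k₀ = 1) (hb₀ : baseMap k₀ = 𝟙 A)
      (z₀ c₀ : Φ'.obj (op A)) (u₀ : B'.obj (op A)) (hz₀ : div k₀ = z₀) (hc₀ : div (ρ k₀) = c₀) (hu₀ : unit k₀ = u₀)
      (S : Φ'.obj (op A)),
      (∀ n : ℕ, ∃ (β β' : Algebra.GrothendieckGroup (Φ.obj (op A)))
        (kn : h.functor.obj ⟨A, β⟩ ⟶ h.functor.obj ⟨A, β'⟩) (zn e : Φ'.obj (op A)),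
          degFr kn = 1 ∧ baseMap kn = 𝟙 A ∧ div kn = zn ∧ unit kn = u₀ ^ n ∧ zn * e = S) →
      ∀ n : ℕ, 1 ≤ n → ∃ e : Φ'.obj (op A), ofR S * (ofR c₀ / ofR z₀) ^ n = ofR e := by
    intro γ₀ γ₀' k₀ hd₀ hb₀ z₀ c₀ u₀ hz₀ hc₀ hu₀ S hS n hn
    obtain ⟨β, β', kn, zn, e, hknd, hknb, hknz, hknu, hkne⟩ := hS n
    obtain ⟨hρknd, hρknb⟩ := hB1 β β' kn hknd hknb
    -- name the image divisor of `kn`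
    obtain ⟨cn, hcn⟩ : ∃ cn : Φ'.obj (op A), div (ρ kn) = cn := ⟨_, rfl⟩
    -- (c5): a morphism `K_n` with unit `u₀^n` and cocycle `δ₀^n`
    obtain ⟨t, Kn, zK, cK, hKd, hKb, hKz, hKu, hKc, hKrel⟩ :=
      h.exists_pow_unit ρ hcomp hmap A hι hB1 γ₀ γ₀' k₀ z₀ u₀ hd₀ hb₀ hz₀ hu₀ c₀ hc₀ n hn
    -- (c4′): `kn` and `K_n` have the same unit `u₀^n`, hence the same cocycle
    have hsame := h.delta_eq_of_unit_eq ρ hcomp hmap A hι hB1 β β' γ₀ t kn Kn zn zK (u₀ ^ n)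
      hknd hknb hknz hknu hKd hKb hKz hKu cn cK hcn hKc
    -- `of cn · of zK = of cK · of zn` and `of cK · of z₀^n = of c₀^n · of zK` ⇒ `of S · δ₀^n = of (e · cn)`
    refine ⟨e * cn, ?_⟩
    have key : ofR zn * (ofR c₀ ^ n / ofR z₀ ^ n) = ofR cn := by
      rw [mul_div_assoc', div_eq_iff_eq_mul, ← mul_left_inj (ofR zK)]
      calc ofR zn * ofR c₀ ^ n * ofR zK = ofR zn * (ofR c₀ ^ n * ofR zK) := by rw [mul_assoc]
        _ = ofR zn * (ofR cK * ofR z₀ ^ n) := by rw [hKrel]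
        _ = (ofR cK * ofR zn) * ofR z₀ ^ n := by ac_rfl
        _ = (ofR cn * ofR zK) * ofR z₀ ^ n := by rw [hsame]
        _ = ofR cn * ofR z₀ ^ n * ofR zK := by ac_rfl
    calc ofR S * (ofR c₀ / ofR z₀) ^ n = ofR (zn * e) * (ofR c₀ ^ n / ofR z₀ ^ n) := by rw [hkne, div_pow]
      _ = ofR e * (ofR zn * (ofR c₀ ^ n / ofR z₀ ^ n)) := by rw [map_mul]; ac_rfl
      _ = ofR e * ofR cn := by rw [key]
      _ = ofR (e * cn) := by rw [map_mul]
  /- (R) small realisations of `u` and of an inverse `u⁻` of `u` -/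
  obtain ⟨S, hS⟩ := hsmall uu
  obtain ⟨uinv, huinv⟩ := hinv uu
  obtain ⟨S', hS'⟩ := hsmall uinv
  -- a realisation `k'` of `u⁻` (n = 1) and its translate `k₂` with source `G(A, γ')`, composable after `k`
  obtain ⟨β, β', k', z', e', hk'd, hk'b, hk'z, hk'u, hk'e⟩ := hS' 1
  rw [pow_one] at hk'u
  have hrel' := h.rel_linear A β β' k' hk'd hk'b z' uinv hk'z hk'u
  let k₂ : h.functor.obj ⟨A, γ'⟩ ⟶ h.functor.obj ⟨A, γ' * β' * β⁻¹⟩ :=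
    ⟨1, 𝟙 A, z', uinv, by
      show (gpApp h.η (op A) γ') ^ ((1 : ℕ+) : ℕ) * Algebra.GrothendieckGroup.of z' =
        pullGp Φ' (𝟙 A) (gpApp h.η (op A) (γ' * β' * β⁻¹)) * divB Φ' B' DivB' (op A) uinv
      rw [PNat.one_coe, pow_one, pullGp_id, map_mul, map_mul, map_inv]
      calc gpApp h.η (op A) γ' * Algebra.GrothendieckGroup.of z'
          = gpApp h.η (op A) γ' * ((gpApp h.η (op A) β)⁻¹ * (gpApp h.η (op A) β * Algebra.GrothendieckGroup.of z')) := by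
            rw [inv_mul_cancel_left]
        _ = gpApp h.η (op A) γ' * ((gpApp h.η (op A) β)⁻¹ * (gpApp h.η (op A) β' * divB Φ' B' DivB' (op A) uinv)) := by
            rw [hrel']
        _ = gpApp h.η (op A) γ' * gpApp h.η (op A) β' * (gpApp h.η (op A) β)⁻¹ * divB Φ' B' DivB' (op A) uinv := by
            ac_rfl⟩
  have hk₂d : degFr k₂ = 1 := rfl
  have hk₂b : baseMap k₂ = 𝟙 A := rfl
  have hk₂z : div k₂ = z' := rfl
  have hk₂u : unit k₂ = uinv := rfl
  obtain ⟨hρk₂d, hρk₂b⟩ := hB1 _ _ k₂ hk₂d hk₂b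
  obtain ⟨c₂, hc₂⟩ : ∃ c₂ : Φ'.obj (op A), div (ρ k₂) = c₂ := ⟨_, rfl⟩
  obtain ⟨u₂', hu₂'⟩ : ∃ u₂' : B'.obj (op A), unit (ρ k₂) = u₂' := ⟨_, rfl⟩
  -- (c7): `c₂ · c = z' · z`, i.e. `δ(k₂) = δ(k)⁻¹`
  have hc7 : c₂ * c = z' * z :=
    h.div_rho_comp_eq_of_unit_mul_eq_one ρ hcomp hmap A hι hsat γ γ' (γ' * β' * β⁻¹) k k₂ z z' c c₂ uu uinv
      uu' u₂' hd hb hz.symm hu.symm hk₂d hk₂b hk₂z hk₂u hρd hρb hc.symm hu'.symm hρk₂d hρk₂b hc₂ hu₂' huinv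
  have hδinv : ofR c₂ / ofR z' = δ⁻¹ := by
    rw [hδ, inv_div, div_eq_div_iff_mul_eq_mul, ← map_mul, ← map_mul, hc7, mul_comm z z']
  /- (Z) `of(S·S') · δ^n` is effective for every `n ∈ ℤ` -/
  have hZ : ∀ n : ℤ, ∃ e : Φ'.obj (op A), ofR (S * S') * δ ^ n = ofR e := by
    intro n
    rcases Int.eq_nat_or_neg n with ⟨m, rfl | rfl⟩
    · rcases Nat.eq_zero_or_pos m with rfl | hm
      · exact ⟨S * S', by rw [Int.ofNat_zero, zpow_zero, mul_one]⟩
      · obtain ⟨e, he⟩ := hP γ γ' k hd hb z c uu hz.symm hc.symm hu.symm S hS m hm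
        refine ⟨S' * e, ?_⟩
        rw [zpow_natCast, map_mul, map_mul, ← he, hδ]
        ac_rfl
    · rcases Nat.eq_zero_or_pos m with rfl | hm
      · exact ⟨S * S', by rw [Int.ofNat_zero, neg_zero, zpow_zero, mul_one]⟩
      · obtain ⟨e, he⟩ := hP γ' (γ' * β' * β⁻¹) k₂ hk₂d hk₂b z' c₂ uinv hk₂z hc₂ hk₂u S' hS' m hm
        refine ⟨S * e, ?_⟩
        rw [zpow_neg, zpow_natCast, ← inv_pow, ← hδinv, map_mul, map_mul, ← he]
        ac_rfl
  /- (C) conclude: `δ = 1`, so `Div(ρ k) = Div k` and `u_{ρ k} = u_k` -/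
  have hδ1 : δ = 1 := hsq δ (S * S') hZ
  have hcz : c = z := by
    apply Algebra.GrothendieckGroup.of_injective (M := Φ'.obj (op A))
    have : ofR c / ofR z = 1 := by rw [← hδ]; exact hδ1
    exact div_eq_one.mp this
  have huu : uu' = uu := by
    apply hdivB
    have h3 := h.of_div_rho_mul_divB_eq A γ γ' k (ρ k) hd hb z uu hz.symm hu.symm hρd hρb c uu' hc.symm hu'.symm
    rw [hcz] at h3
    exact (mul_left_cancel h3).symm
  exact ModelFrobenioid.hom_ext (hρd.trans hd.symm) (hρb.trans hb.symm) (hc.symm.trans (hcz.trans hz))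
    (hu'.symm.trans (huu.trans hu))

end ModelFrobenioid.DataHom

namespace FrdI.Cor54Sub

open CategoryTheory Opposite ModelFrobenioid NumberField IsDedekindDomain Literature.IUT.LogVolume

variable {F : Type} [Field F] [NumberField F] {K : Type} [Field K] [Algebra F K]
  (hΦ : PreFrobenioid.IsPerfFactorialOn (arithDivisorFunctor F K))

/-! ### The arithmetic instantiation: `C_{K/F}` -/

/-- **Hom-rigidity on identity-base linear morphisms at `C_{K/F}`**, modulo the one arithmetic input still owed by
another seat (named hypothesis, in its producer's shape): `hsmall` — small realisations of unit classes (sub-row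
(D1)). Everything else is supplied BY NAME: `ι^gp` injective (`RealificationData.canonical_toRlfGp_injective`),
`Φ^rlf(L)` cancellative (`IsPerfFactorial.Rlf.isCancelMul`), saturation (abc-iut-L1-d8's `toRlf_saturated_arith`),
`Div_{B'}` = inclusion, the archimedean squeeze (abc-iut-L1-d9's `ArithRlfCoord.rlfGp_eq_one_of_forall_zpow_effective`),
(B1) (abc-iut-L1-d8's `degFr_base_rho_linear_arith`). [cite: MochizukiFrdI2008, Cor. 5.4 p.104] -/
theorem hlin_arith_of
    (ρ : ∀ ⦃a a' : (PreFrobenioid.biratSubfunctor (ModelFrobenioid.toElem (arithDivisorFunctor F K) (unitsFunctor F K)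
        (divNatTrans F K))).ModelOf⦄,
      (((RealificationData.canonical (arithDivisorFunctor F K) (PreFrobenioid.IsPerfFactorialOn.op hΦ)).ofBaseData
          (PreFrobenioid.biratSubfunctor (ModelFrobenioid.toElem (arithDivisorFunctor F K) (unitsFunctor F K)
            (divNatTrans F K)))).functor.obj a ⟶
        ((RealificationData.canonical (arithDivisorFunctor F K) (PreFrobenioid.IsPerfFactorialOn.op hΦ)).ofBaseData
          (PreFrobenioid.biratSubfunctor (ModelFrobenioid.toElem (arithDivisorFunctor F K) (unitsFunctor F K)
            (divNatTrans F K)))).functor.obj a') →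
      (((RealificationData.canonical (arithDivisorFunctor F K) (PreFrobenioid.IsPerfFactorialOn.op hΦ)).ofBaseData
          (PreFrobenioid.biratSubfunctor (ModelFrobenioid.toElem (arithDivisorFunctor F K) (unitsFunctor F K)
            (divNatTrans F K)))).functor.obj a ⟶
        ((RealificationData.canonical (arithDivisorFunctor F K) (PreFrobenioid.IsPerfFactorialOn.op hΦ)).ofBaseData
          (PreFrobenioid.biratSubfunctor (ModelFrobenioid.toElem (arithDivisorFunctor F K) (unitsFunctor F K)
            (divNatTrans F K)))).functor.obj a'))
    (hcomp : ∀ ⦃a a' a''⦄ (k : _ ⟶ _) (l : _ ⟶ _), ρ (a := a) (a' := a'') (k ≫ l) = ρ (a := a) (a' := a') k ≫ ρ (a := a') (a' := a'') l)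
    (hmap : ∀ ⦃a a'⦄ (f : a ⟶ a'), ρ (((RealificationData.canonical (arithDivisorFunctor F K)
        (PreFrobenioid.IsPerfFactorialOn.op hΦ)).ofBaseData (PreFrobenioid.biratSubfunctor (ModelFrobenioid.toElem
          (arithDivisorFunctor F K) (unitsFunctor F K) (divNatTrans F K)))).functor.map f) =
      ((RealificationData.canonical (arithDivisorFunctor F K) (PreFrobenioid.IsPerfFactorialOn.op hΦ)).ofBaseData
        (PreFrobenioid.biratSubfunctor (ModelFrobenioid.toElem (arithDivisorFunctor F K) (unitsFunctor F K)
          (divNatTrans F K)))).functor.map f)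
    (A : FinSubextCat F K)
    (hsmall : ∀ uu : ((RealificationData.canonical (arithDivisorFunctor F K) (PreFrobenioid.IsPerfFactorialOn.op hΦ)).realSpan
        (PreFrobenioid.biratSubfunctor (ModelFrobenioid.toElem (arithDivisorFunctor F K) (unitsFunctor F K)
          (divNatTrans F K)))).toMonoid.obj (op A),
      ∃ S : (RealificationData.canonical (arithDivisorFunctor F K) (PreFrobenioid.IsPerfFactorialOn.op hΦ)).rlf.obj (op A),
      ∀ n : ℕ, ∃ (β β' : Algebra.GrothendieckGroup ((arithDivisorFunctor F K).obj (op A)))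
        (kn : ((RealificationData.canonical (arithDivisorFunctor F K) (PreFrobenioid.IsPerfFactorialOn.op hΦ)).ofBaseData
            (PreFrobenioid.biratSubfunctor (ModelFrobenioid.toElem (arithDivisorFunctor F K) (unitsFunctor F K)
              (divNatTrans F K)))).functor.obj ⟨A, β⟩ ⟶
          ((RealificationData.canonical (arithDivisorFunctor F K) (PreFrobenioid.IsPerfFactorialOn.op hΦ)).ofBaseData
            (PreFrobenioid.biratSubfunctor (ModelFrobenioid.toElem (arithDivisorFunctor F K) (unitsFunctor F K)
              (divNatTrans F K)))).functor.obj ⟨A, β'⟩)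
        (zn e : (RealificationData.canonical (arithDivisorFunctor F K) (PreFrobenioid.IsPerfFactorialOn.op hΦ)).rlf.obj (op A)),
        degFr kn = 1 ∧ baseMap kn = 𝟙 A ∧ div kn = zn ∧ unit kn = uu ^ n ∧ zn * e = S)
    (γ γ' : Algebra.GrothendieckGroup ((arithDivisorFunctor F K).obj (op A)))
    (k : ((RealificationData.canonical (arithDivisorFunctor F K) (PreFrobenioid.IsPerfFactorialOn.op hΦ)).ofBaseData
        (PreFrobenioid.biratSubfunctor (ModelFrobenioid.toElem (arithDivisorFunctor F K) (unitsFunctor F K)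
          (divNatTrans F K)))).functor.obj ⟨A, γ⟩ ⟶
      ((RealificationData.canonical (arithDivisorFunctor F K) (PreFrobenioid.IsPerfFactorialOn.op hΦ)).ofBaseData
        (PreFrobenioid.biratSubfunctor (ModelFrobenioid.toElem (arithDivisorFunctor F K) (unitsFunctor F K)
          (divNatTrans F K)))).functor.obj ⟨A, γ'⟩)
    (hd : degFr k = 1) (hb : baseMap k = 𝟙 A) : ρ k = k := by
  have hM : IsPerfFactorial (Multiplicative (EffArithDivisor A.L)) := PreFrobenioid.IsPerfFactorialOn.op hΦ (op A)
  haveI : IsCancelMul ((RealificationData.canonical (arithDivisorFunctor F K)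
      (PreFrobenioid.IsPerfFactorialOn.op hΦ)).rlf.obj (op A)) := IsPerfFactorial.Rlf.isCancelMul hM
  refine ModelFrobenioid.DataHom.eq_of_linear_of_inputs _ ρ hcomp hmap A
    (RealificationData.canonical_toRlfGp_injective (PreFrobenioid.IsPerfFactorialOn.op hΦ) A)
    (toRlf_saturated_arith (PreFrobenioid.IsPerfFactorialOn.op hΦ) _ A) ?_ ?_ ?_ ?_ hsmall γ γ' k hd hb
  · -- `Div_{B'}` on `ℝ · Φ^birat` is the inclusion of a subgroup
    exact fun x y hxy => Subtype.ext hxy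
  · -- `(ℝ · Φ^birat)(A)` is a group
    intro uu
    refine ⟨⟨uu.1⁻¹, inv_mem uu.2⟩, Subtype.ext ?_⟩
    show uu.1⁻¹ * uu.1 = 1
    exact inv_mul_cancel _
  · -- the archimedean squeeze of abc-iut-L1-d9
    intro δ c hc
    exact ArithRlfCoord.rlfGp_eq_one_of_forall_zpow_effective hM δ c hc
  · -- (B1): abc-iut-L1-d8's `degFr_base_rho_linear_arith` (degree by the coordinate inequality, base by p427274)
    intro γ₁ γ₁' k₁ hd₁ hb₁
    exact degFr_base_rho_linear_arith (PreFrobenioid.IsPerfFactorialOn.op hΦ) _ ρ hcomp hmap A γ₁ γ₁' k₁ hd₁ hb₁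

/-- **`hrig` at `C_{K/F}`** (the hypothesis of `FrdI.Cor54Sub.strongUnique_of_rigidAlong_untrToRlf`, p420214): every
endofunctor `T` of THE realification `C_{K/F}^rlf` with `untrToRlf ⋙ T ≅ untrToRlf` is `≅ 𝟭` — from `hlin_arith_of`
(for every `ρ`), abc-iut-L1-d8's `homRigid_of_homRigid_linear`, abc-iut-w5-d048's `rigidAlong_of_exists_iso_of_homRigid`
and (a′) `untrToRlf_exists_iso_arith`; modulo the one named input `hsmall` (D1). [cite: MochizukiFrdI2008, Cor. 5.4 p.104] -/
theorem hrig_arith_of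
    (hsmall : ∀ (A : FinSubextCat F K) (uu : ((RealificationData.canonical (arithDivisorFunctor F K) (PreFrobenioid.IsPerfFactorialOn.op hΦ)).realSpan (PreFrobenioid.biratSubfunctor (ModelFrobenioid.toElem (arithDivisorFunctor F K) (unitsFunctor F K) (divNatTrans F K)))).toMonoid.obj (op A)),
      ∃ S : (RealificationData.canonical (arithDivisorFunctor F K) (PreFrobenioid.IsPerfFactorialOn.op hΦ)).rlf.obj (op A), ∀ n : ℕ, ∃ (β β' : Algebra.GrothendieckGroup ((arithDivisorFunctor F K).obj (op A)))
        (kn : ((RealificationData.canonical (arithDivisorFunctor F K) (PreFrobenioid.IsPerfFactorialOn.op hΦ)).ofBaseData (PreFrobenioid.biratSubfunctor (ModelFrobenioid.toElem (arithDivisorFunctor F K) (unitsFunctor F K) (divNatTrans F K)))).functor.obj ⟨A, β⟩ ⟶ ((RealificationData.canonical (arithDivisorFunctor F K) (PreFrobenioid.IsPerfFactorialOn.op hΦ)).ofBaseData (PreFrobenioid.biratSubfunctor (ModelFrobenioid.toElem (arithDivisorFunctor F K) (unitsFunctor F K) (divNatTrans F K)))).functor.obj ⟨A, β'⟩) (zn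 e : (RealificationData.canonical (arithDivisorFunctor F K) (PreFrobenioid.IsPerfFactorialOn.op hΦ)).rlf.obj (op A)),
        degFr kn = 1 ∧ baseMap kn = 𝟙 A ∧ div kn = zn ∧ unit kn = uu ^ n ∧ zn * e = S) :
    ∀ T : PreFrobenioid.rlf (ModelFrobenioid.toElem (arithDivisorFunctor F K) (unitsFunctor F K) (divNatTrans F K)) hΦ ⥤
        PreFrobenioid.rlf (ModelFrobenioid.toElem (arithDivisorFunctor F K) (unitsFunctor F K) (divNatTrans F K)) hΦ,
      Nonempty (PreFrobenioid.untrToRlf (ModelFrobenioid.toElem (arithDivisorFunctor F K) (unitsFunctor F K)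
          (divNatTrans F K)) hΦ ⋙ T ≅
        PreFrobenioid.untrToRlf (ModelFrobenioid.toElem (arithDivisorFunctor F K) (unitsFunctor F K) (divNatTrans F K)) hΦ) →
      Nonempty (T ≅ 𝟭 _) :=
  rigidAlong_of_exists_iso_of_homRigid
    (PreFrobenioid.untrToRlf (ModelFrobenioid.toElem (arithDivisorFunctor F K) (unitsFunctor F K) (divNatTrans F K)) hΦ)
    (untrToRlf_exists_iso_arith hΦ)
    fun ρ hc hm => ModelFrobenioid.DataHom.homRigid_of_homRigid_linear ((RealificationData.canonical (arithDivisorFunctor F K) (PreFrobenioid.IsPerfFactorialOn.op hΦ)).ofBaseData (PreFrobenioid.biratSubfunctor (ModelFrobenioid.toElem (arithDivisorFunctor F K) (unitsFunctor F K) (divNatTrans F K)))) ρ hc hm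
      fun A γ γ' k hd hb => hlin_arith_of hΦ ρ hc hm A (hsmall A) γ γ' k hd hb

/-! ### (D1) from abc-iut-L1-d2's fractional parts, and the unconditional statements -/

/-- **(D1) at `C_{K/F}`: small realisations of unit classes.** For every unit class `U ∈ (ℝ · Φ^birat)(A)` there is
ONE `S ∈ Φ^rlf(L)` such that every power `U^n` is the unit coordinate of an identity-base linear morphism
`(1, 𝟙, z_n, U^n) : G(A, 1) → G(A, g_n)` between `untrToRlf`-image objects with `z_n ∣ S` — from abc-iut-L1-d2's
`ArithRlfCoord.exists_fractionalPart_of_eq` (fractional parts of the finite coordinates, integer parts `g_n`).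
[cite: MochizukiFrdI2008, Cor. 5.4 p.104] -/
theorem hsmall_arith (A : FinSubextCat F K) (uu : ((RealificationData.canonical (arithDivisorFunctor F K) (PreFrobenioid.IsPerfFactorialOn.op hΦ)).realSpan (PreFrobenioid.biratSubfunctor (ModelFrobenioid.toElem (arithDivisorFunctor F K) (unitsFunctor F K) (divNatTrans F K)))).toMonoid.obj (op A)) :
    ∃ S : (RealificationData.canonical (arithDivisorFunctor F K) (PreFrobenioid.IsPerfFactorialOn.op hΦ)).rlf.obj (op A), ∀ n : ℕ, ∃ (β β' : Algebra.GrothendieckGroup ((arithDivisorFunctor F K).obj (op A)))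
      (kn : ((RealificationData.canonical (arithDivisorFunctor F K) (PreFrobenioid.IsPerfFactorialOn.op hΦ)).ofBaseData (PreFrobenioid.biratSubfunctor (ModelFrobenioid.toElem (arithDivisorFunctor F K) (unitsFunctor F K) (divNatTrans F K)))).functor.obj ⟨A, β⟩ ⟶ ((RealificationData.canonical (arithDivisorFunctor F K) (PreFrobenioid.IsPerfFactorialOn.op hΦ)).ofBaseData (PreFrobenioid.biratSubfunctor (ModelFrobenioid.toElem (arithDivisorFunctor F K) (unitsFunctor F K) (divNatTrans F K)))).functor.obj ⟨A, β'⟩) (zn e : (RealificationData.canonical (arithDivisorFunctor F K) (PreFrobenioid.IsPerfFactorialOn.op hΦ)).rlf.obj (op A)),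
      degFr kn = 1 ∧ baseMap kn = 𝟙 A ∧ div kn = zn ∧ unit kn = uu ^ n ∧ zn * e = S := by
  have hM : IsPerfFactorial (Multiplicative (EffArithDivisor A.L)) := PreFrobenioid.IsPerfFactorialOn.op hΦ (op A)
  obtain ⟨S, hS⟩ := ArithRlfCoord.exists_fractionalPart_of_eq hM (((RealificationData.canonical (arithDivisorFunctor F K) (PreFrobenioid.IsPerfFactorialOn.op hΦ)).ofBaseData (PreFrobenioid.biratSubfunctor (ModelFrobenioid.toElem (arithDivisorFunctor F K) (unitsFunctor F K) (divNatTrans F K)))).η.app (op A)).hom (fun _ => rfl) uu.1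
  refine ⟨(((RealificationData.canonical (arithDivisorFunctor F K) (PreFrobenioid.IsPerfFactorialOn.op hΦ)).ofBaseData (PreFrobenioid.biratSubfunctor (ModelFrobenioid.toElem (arithDivisorFunctor F K) (unitsFunctor F K) (divNatTrans F K)))).η.app (op A)).hom S, fun n => ?_⟩
  obtain ⟨z, g, hz, ⟨e, he⟩⟩ := hS n
  refine ⟨1, g, ⟨1, 𝟙 A, z, uu ^ n, ?_⟩, z, e, rfl, rfl, rfl, rfl, he.symm⟩
  show (gpApp ((RealificationData.canonical (arithDivisorFunctor F K) (PreFrobenioid.IsPerfFactorialOn.op hΦ)).ofBaseData (PreFrobenioid.biratSubfunctor (ModelFrobenioid.toElem (arithDivisorFunctor F K) (unitsFunctor F K) (divNatTrans F K)))).η (op A) 1) ^ ((1 : ℕ+) : ℕ) * Algebra.GrothendieckGroup.of (M := (RealificationData.canonical (arithDivisorFunctor F K) (PreFrobenioid.IsPerfFactorialOn.op hΦ)).rlf.obj (op A)) z =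
    pullGp (RealificationData.canonical (arithDivisorFunctor F K) (PreFrobenioid.IsPerfFactorialOn.op hΦ)).rlf (𝟙 A) (gpApp ((RealificationData.canonical (arithDivisorFunctor F K) (PreFrobenioid.IsPerfFactorialOn.op hΦ)).ofBaseData (PreFrobenioid.biratSubfunctor (ModelFrobenioid.toElem (arithDivisorFunctor F K) (unitsFunctor F K) (divNatTrans F K)))).η (op A) g) *
      divB (RealificationData.canonical (arithDivisorFunctor F K) (PreFrobenioid.IsPerfFactorialOn.op hΦ)).rlf ((RealificationData.canonical (arithDivisorFunctor F K) (PreFrobenioid.IsPerfFactorialOn.op hΦ)).realSpan (PreFrobenioid.biratSubfunctor (ModelFrobenioid.toElem (arithDivisorFunctor F K) (unitsFunctor F K) (divNatTrans F K)))).toMonoid ((RealificationData.canonical (arithDivisorFunctor F K) (PreFrobenioid.IsPerfFactorialOn.op hΦ)).realSpan (PreFrobenioid.biratSubfunctor (ModelFrobenioid.toElem (arithDivisorFunctor F K) (unitsFunctor F K) (divNatTrans F K)))).incl (op A) (uu ^ n)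
  rw [PNat.one_coe, pow_one, map_one, one_mul, pullGp_id]
  rw [zpow_natCast] at hz
  exact hz

/-- **Hom-rigidity on identity-base linear morphisms at `C_{K/F}`, UNCONDITIONAL**: for every functorial self-map
`ρ` of the morphisms between `untrToRlf`-image objects fixing the images, `ρ k = k` for every identity-base linear
`k : G(A, γ) → G(A, γ')`. [cite: MochizukiFrdI2008, Cor. 5.4 p.104] -/
theorem hlin_arith
    (ρ : ∀ ⦃a a' : (PreFrobenioid.biratSubfunctor (ModelFrobenioid.toElem (arithDivisorFunctor F K) (unitsFunctor F K) (divNatTrans F K))).ModelOf⦄, (((RealificationData.canonical (arithDivisorFunctor F K) (PreFrobenioid.IsPerfFactorialOn.op hΦ)).ofBaseData (PreFrobenioid.biratSubfunctor (ModelFrobenioid.toElem (arithDivisorFunctor F K) (unitsFunctor F K) (divNatTrans F K)))).functor.obj a ⟶ ((RealificationData.canonical (arithDivisorFunctor F K) (PreFrobenioid.IsPerfFactorialOn.op hΦ)).ofBaseData (PreFrobenioid.biratSubfunctor (ModelFrobenioid.toElem (arithDivisorFunctor F K) (unitsFunctor F K) (divNatTrans F K)))).functor.obj a') → (((RealificationData.canonical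 (arithDivisorFunctor F K) (PreFrobenioid.IsPerfFactorialOn.op hΦ)).ofBaseData (PreFrobenioid.biratSubfunctor (ModelFrobenioid.toElem (arithDivisorFunctor F K) (unitsFunctor F K) (divNatTrans F K)))).functor.obj a ⟶ ((RealificationData.canonical (arithDivisorFunctor F K) (PreFrobenioid.IsPerfFactorialOn.op hΦ)).ofBaseData (PreFrobenioid.biratSubfunctor (ModelFrobenioid.toElem (arithDivisorFunctor F K) (unitsFunctor F K) (divNatTrans F K)))).functor.obj a'))
    (hcomp : ∀ ⦃a a' a''⦄ (k : ((RealificationData.canonical (arithDivisorFunctor F K) (PreFrobenioid.IsPerfFactorialOn.op hΦ)).ofBaseData (PreFrobenioid.biratSubfunctor (ModelFrobenioid.toElem (arithDivisorFunctor F K) (unitsFunctor F K) (divNatTrans F K)))).functor.obj a ⟶ ((RealificationData.canonical (arithDivisorFunctor F K) (PreFrobenioid.IsPerfFactorialOn.op hΦ)).ofBaseData (PreFrobenioid.biratSubfunctor (ModelFrobenioid.toElem (arithDivisorFunctor F K) (unitsFunctor F K) (divNatTrans F K)))).functor.obj a') (l : ((RealificationData.canonical (arithDivisorFunctor F K) (PreFrobenioid.IsPerfFactorialOn.op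 hΦ)).ofBaseData (PreFrobenioid.biratSubfunctor (ModelFrobenioid.toElem (arithDivisorFunctor F K) (unitsFunctor F K) (divNatTrans F K)))).functor.obj a' ⟶ ((RealificationData.canonical (arithDivisorFunctor F K) (PreFrobenioid.IsPerfFactorialOn.op hΦ)).ofBaseData (PreFrobenioid.biratSubfunctor (ModelFrobenioid.toElem (arithDivisorFunctor F K) (unitsFunctor F K) (divNatTrans F K)))).functor.obj a''), ρ (k ≫ l) = ρ k ≫ ρ l)
    (hmap : ∀ ⦃a a'⦄ (f : a ⟶ a'), ρ (((RealificationData.canonical (arithDivisorFunctor F K) (PreFrobenioid.IsPerfFactorialOn.op hΦ)).ofBaseData (PreFrobenioid.biratSubfunctor (ModelFrobenioid.toElem (arithDivisorFunctor F K) (unitsFunctor F K) (divNatTrans F K)))).functor.map f) = ((RealificationData.canonical (arithDivisorFunctor F K) (PreFrobenioid.IsPerfFactorialOn.op hΦ)).ofBaseData (PreFrobenioid.biratSubfunctor (ModelFrobenioid.toElem (arithDivisorFunctor F K) (unitsFunctor F K) (divNatTrans F K)))).functor.map f)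
    (A : FinSubextCat F K) (γ γ' : Algebra.GrothendieckGroup ((arithDivisorFunctor F K).obj (op A)))
    (k : ((RealificationData.canonical (arithDivisorFunctor F K) (PreFrobenioid.IsPerfFactorialOn.op hΦ)).ofBaseData (PreFrobenioid.biratSubfunctor (ModelFrobenioid.toElem (arithDivisorFunctor F K) (unitsFunctor F K) (divNatTrans F K)))).functor.obj ⟨A, γ⟩ ⟶ ((RealificationData.canonical (arithDivisorFunctor F K) (PreFrobenioid.IsPerfFactorialOn.op hΦ)).ofBaseData (PreFrobenioid.biratSubfunctor (ModelFrobenioid.toElem (arithDivisorFunctor F K) (unitsFunctor F K) (divNatTrans F K)))).functor.obj ⟨A, γ'⟩) (hd : degFr k = 1) (hb : baseMap k = 𝟙 A) : ρ k = k :=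
  hlin_arith_of hΦ ρ hcomp hmap A (hsmall_arith hΦ A) γ γ' k hd hb

/-- **`hrig` at `C_{K/F}`, UNCONDITIONAL** — the hypothesis of `FrdI.Cor54Sub.strongUnique_of_rigidAlong_untrToRlf`
(p420214) at THE arithmetic data: every endofunctor `T` of `C_{K/F}^rlf` with `untrToRlf ⋙ T ≅ untrToRlf` is `≅ 𝟭`.
With the square of Cor. 5.4 (row C54/L05–L06) this is the as-typed STRONG 1-uniqueness clause of
`PreFrobenioid.Cor54` at `C_{K/F}` (abc-iut-w5-d048's assembly, sub-row (5)). [cite: MochizukiFrdI2008, Cor. 5.4 p.104] -/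
theorem hrig_arith :
    ∀ T : PreFrobenioid.rlf (ModelFrobenioid.toElem (arithDivisorFunctor F K) (unitsFunctor F K) (divNatTrans F K)) hΦ ⥤
        PreFrobenioid.rlf (ModelFrobenioid.toElem (arithDivisorFunctor F K) (unitsFunctor F K) (divNatTrans F K)) hΦ,
      Nonempty (PreFrobenioid.untrToRlf (ModelFrobenioid.toElem (arithDivisorFunctor F K) (unitsFunctor F K)
          (divNatTrans F K)) hΦ ⋙ T ≅
        PreFrobenioid.untrToRlf (ModelFrobenioid.toElem (arithDivisorFunctor F K) (unitsFunctor F K) (divNatTrans F K)) hΦ) →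
      Nonempty (T ≅ 𝟭 _) :=
  hrig_arith_of hΦ (hsmall_arith hΦ)

end FrdI.Cor54Sub

end Literature.AlgebraicGeometry.Frobenioids

end
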